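import Mathlib
import HarnessLib
import HarnessLib.Audit
import Summits.FinalStateConjecture.Statement
import Literature.Geometry.Lorentzian.FinalEraPackage2
import Summits.FinalStateConjecture.FinalStateConjecture.Theorems.DissipativeFinalMotionsAssemblyT2
import HarnessLib.Audit.Status.Attr

/-!
Route: DissipativeFinalMotions

DORMANT since 2026-08-24T22:42:23Z (reconciler: no traction for 7.1 d (last activity item-evidence-added at 2026-08-17T18:53:21Z); parked, not closed — `ledger route dormant route-FinalStateConjecture-DissipativeFinalMotions --off` to r) — unstaffed, not closed; items shared with open routes are served there. `ledger route dormant <id> --off` reactivates.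

# Route DissipativeFinalMotions — No eternal loitering — dissipative N-body modulation turns "moving
apart" into a radiated-energy floor plus dispersing capture

It suffices to show X = FinalEraGeneric ∧ RadiativeLyapunovBudget ∧ DispersingCapture (plus the
provable-now support
DispersalFromBudget, proved). Card realised: final-motions-dissipative-marchal-saari ("modulation
onto a dissipative gravitational
N-body system"). FinalEraGeneric (pre-phase, rank 4; rev 3 = statement re-type T2):
TAME-Christodoulou-generic admissible data
(the Statement's `IsTameChristodoulouGeneric … 1`: witness families tame on ONE fixed end, immersed
at 0) have an MGHD, and every
MGHD has complete 𝓘⁺ and enters a FINAL ERA — the 31-conjunct package (rev 2), now spelled through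
the landed Literature predicate
`CauchyDevelopment.IsFinalEra₂` (FinalEraPackage2.lean): N rest-frame Kerr–Schild near-zone charts
Ψᵢ and one flat chart Ψ₀
exhausting the self-determined exterior O, worldlines ξᵢ(t) of the holes in the flat chart obeying a
near-Newtonian MODULATION LAW
‖ξ̈ᵢ + Σⱼ Mⱼ(ξᵢ−ξⱼ)/|ξᵢ−ξⱼ|³‖ ≤ κ Σⱼ (Mⱼ/d²ᵢⱼ)(|ξ̇ᵢ|²+|ξ̇ⱼ|²+μ/dᵢⱼ) + β(t) (β ∈ L¹), a separation
floor δ, speeds ≤ V < 1,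
scale-covariant Kerr-closeness of every near zone {rᵢ ≤ 2ρ₀} (order-m deviation ≤ 1/(100·Mᵢ^m), m ≤
2), pairwise disjoint
certified tubes and r₊ < ρ₀, C² convergence of eventually-isolated holes, chart-localisation and
exhaustion clauses — PLUS
(rev 3) the three intrinsic clauses the re-typed Statement asks of a settled exterior, in rest-frame
form: (R) every
future-complete normalised null ray from Σ stays in closure O (`RaysStayInClosure`), (F) every hole
chart is eventually
future-oriented on every truncated slab {t*ᵢ = τ, rᵢ ≤ ρ} (push-forward of the background's future
timelike field
V_{Mᵢ,aᵢ} = −g♯(dt*), `Kerr.timeVector`, future-directed causal), (F₀) the flat chart is eventually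
future-oriented beyond a
fixed distance ϱ₀ from the holes (push-forward of ∂₀ future-directed causal).
RadiativeLyapunovBudget (rank 2, the card's bet in
the form the typed Statement needs; unchanged): for every such era there is a non-increasing,
bounded-below function E of chart
time (intended: the Bondi mass) which drops by ε(D) > 0 within a lag L(D) whenever two holes stay
D-close for one unit of time —
bounded and oscillatory (Sitnikov/Alekseev) sub-clusters cost energy at every recurrence.
DispersalFromBudget (support, real
analysis, PROVED p99650): such a budget forces dᵢⱼ(t) → ∞ for every pair. DispersingCapture (rank 3;
rev 3): a final era with
(R), (F), (F₀) whose holes pairwise disperse settles in the re-typed sense — Cesàro velocities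
exist, near zones converge to
sub-extremal Kerr on HONEST growing zones Rᵢ(τ) → ∞, and the boosted orthochronous charts, sublinear
straight tubes,
RaysStayInClosure, HasExhaustiveCharts and IsFutureOriented of the Statement are assembled ((F)
transports verbatim:
the boosted background's time/radius are the rest-frame ones and the Statement's vector is Λᵢ
V(Λᵢ⁻¹(x − cᵢ))). The typed
Statement tolerates any sublinear drift ("even parabolic t^{2/3}"), so the Chazy–Marchal–Saari rate
classification is a
strengthening, not load-bearing (see Two-layer plan).
Lean: `FinalEraGeneric ∧ RadiativeLyapunovBudget ∧ DispersalFromBudget ∧ DispersingCapture`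

## Assembly
Pure logic, sorry-free, supplied as glue.lean `closes (h₃ : FinalEraGeneric) (h₁ :
RadiativeLyapunovBudget) (h₄ : DispersingCapture) :
FinalStateConjecture` — rev 3b (2026-08-16): hypotheses = the three CRUXES only (axioms propext,
Classical.choice, Quot.sound); the
PROVED support DispersalFromBudget (Theorems/DissipativeFinalMotionsDispersalFromBudget.lean,
`DispersalFromBudget_proof` @ 01abd5044f03
— that module imports this file, so no `_holds` link can be rendered here) is replayed inline
verbatim, and the frame item Assembly is
proved inline and applied (`exact hA ⟨h₃, h₁, h₂, h₄⟩`). Content of the frame: TAME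
Christodoulou-genericity `IsTameChristodoulouGeneric
𝓓 P 1 = HasTameCodimAtLeastIn 𝓓 {d ∈ 𝓓 | ¬P d} 1` is monotone under pointwise implication on 𝓓 (the
end e, the family F, tameness
and immersion are kept), and pointwise FinalEraGeneric's package (`IsFinalEra₂`, by `Iff.rfl` the
inline 31-clause hypothesis of
RadiativeLyapunovBudget) is fed to RadiativeLyapunovBudget (∃E), the budget and the package's
Lipschitz clause (conjunct 14) to
DispersalFromBudget (dispersal), and package + (R), (F), (F₀) + dispersal to DispersingCapture,
whose conclusion is verbatim the
re-typed Statement's. The bookkeeping item Assembly (rev 3: uncurried `FinalEraGeneric ∧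
RadiativeLyapunovBudget ∧ DispersalFromBudget ∧
DispersingCapture → FinalStateConjecture`, literally X → Statement) replaces the curried rev-2 item
stmt-FinalStateConjecture-10157
(proved for rev 2 by Theorems/DissipativeFinalMotionsAssembly.lean, bodies inlined against the OLD
Statement). PROVERS: nothing is
gained by closing this bookkeeping item — `closes` below carries its proof; work the cruxes. If you
do close it, do so ONLY from a
module that does NOT import this Theses file (state the type with the four item bodies inlined
verbatim, cf.
Theorems/PhotonSphereChannelsAssemblyFrame.lean), else its `_holds` link cannot be rendered (import
cycle).

Rationale: WHY THIS LINE. After the last strong-field event the exterior is a weakly coupled N-body system: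
modulation theory (Martel–Merle–Tsai
arXiv:math/0112071; gravitational Hartree two-solitons following Kepler hyperbolae/parabolae,
Krieger–Martel–Raphaël
arXiv:0811.4596; many-body laws for Hartree multisolitons arXiv:2501.18398) and the problem of
motion (EIH doi:10.2307/1968714,
Blanchet arXiv:1310.1528, Hintz arXiv:2306.07409/2408.06715) say the moduli obey Newton's equations
plus post-Newtonian slack,
and celestial mechanics classifies the final evolutions of such systems (Chazy 1922; Marchal–Saari
doi:10.1016/0022-0396(76)90101-7; expanding systems, Saari doi:10.2307/1995609, Pollard
zbl:0159.26102). The one thing the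
conservative classification allows and the conjecture forbids — eternal bounded or oscillatory
sub-clusters — is exactly what
the SIGN of gravitational radiation removes: in consequence form, a monotone bounded budget that
every recurrence taxes by a
fixed amount (the dissipative Kepler problem, Margheri–Ortega–Rebelo arXiv:1207.5001, is the N = 2
toy). Reading the typed
Statement closely shows that only dispersal + Cesàro velocities + capture are needed, so the route
isolates three seams: a
quantitative "loitering radiates" floor (new as a statement; the stationary no-parking theorems
arXiv:0905.4179 are its
zero-velocity shadow), a dispersing multi-Kerr capture theorem, and the honest pre-phase. Imported
areas: celestial mechanics
(final motions), dispersive-PDE modulation, post-Newtonian theory; no prior route exists on this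
summit and the negatives index
is empty. Rev 3 (2026-08-16) follows the statement re-type T2 (p126844): tame genericity on one
fixed end, the intrinsic
ray clause and chart time-orientation are threaded through FinalEraGeneric / DispersingCapture; the
mechanism is unchanged.

RANKED CRUXES. #2 RadiativeLyapunovBudget (crux) — For admissible data, a maximal vacuum Cauchy
development with complete 𝓘⁺, and ANY final-era package (the 31 conjuncts of FinalEraGeneric rev 2:
clauses 1–21 and 23–29 as at open; clause 22 is now the SCALE-COVARIANT near-zone pin — for m ≤ 2
the order-m coordinate derivatives of Ψᵢ*g − g_{Mᵢ,aᵢ} on the certified slabs {t*ᵢ = τ, rᵢ ≤ 2ρ₀}, τ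
≥ T, are ≤ 1/(100·Mᵢ^m) (C⁰ tolerance 1/100 as before, C¹ and C² in the label's own mass unit, so
curvature is pinned to Kerr(Mᵢ,aᵢ)'s at the 1 % level near r₊ and a chart into a nearly flat region
cannot pose as a near zone); clause 30: the certified tubes Ψᵢ({t*ᵢ > T, rᵢ ≤ 2ρ₀}) are pairwise
DISJOINT (distinct labels are distinct holes — kills the twin/phantom-binary witness of rev 1);
clause 31: r₊(Mᵢ,aᵢ) < ρ₀ (certified zones are non-degenerate shells reaching from the horizon past
2r₊), all taken as hypotheses), there is E : ℝ → ℝ, antitone on [T,∞) and bounded below there, such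
that for every D > 0 there are ε > 0 and a lag L ≥ 0 with E(t+L) ≤ E(t) − ε whenever two distinct
labels satisfy ‖ξᵢ(s) − ξⱼ(s)‖ ≤ D for all s ∈ [t, t+1] (t ≥ T). Intended witness: the Bondi mass
along cuts adapted to the flat chart (mass loss + positivity; Cauchy-side ports exist in tree:
BondiSachsRadiativeEnd.bondiMass_antitoneOn, BondiMassCauchy.bondiMass_nonneg/le_admEnergy), plus a
uniform lower bound ε(D) on the energy radiated within lag L(D) by two genuinely distinct black
holes that stay D-close for a unit of time (all-multipole "no non-radiating bounded motion"; the
quadrupole alone is not enough: Lagrange triangle). Repaired rev 2 (2026-08-15) after the paper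
refutation of rev 1 by a phantom/twin binary sharing one hole chart (refuter rreview-0815T15-8-0,
retriage planner): supersedes stmt-FinalStateConjecture-10153, whose notes/evidence apply verbatim
otherwise. [difficulty: XL] (why it might fail: Needs Bondi-mass loss+positivity over
CauchyDevelopment and a UNIFORM all-multipole floor ε(D) for distinct loitering holes (none in
print); and a phantom label might still satisfy clauses 22/30/31 (e.g. huge-mass fake zone by
long-wave spacelike corrugation) ⇒ misstated again.) [ChristodoulouKlainerman1993PMS41,
arXiv:gr-qc/0307109, SchoenYau1982, Blanchet2024, arXiv:0905.4179, AlexakisSchlue2018,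
arXiv:1207.5001, MarchalSaari1976, arXiv:2304.08455]
#3 DispersingCapture (crux) — rev 3 (statement re-type T2). For admissible data, an MGHD with
complete 𝓘⁺ and binders N … O satisfying the 31-clause rev-2 package
`𝒟.toCauchyDevelopment.IsFinalEra₂ N M a T δ V C₁ C₂ ρ₀ κ ξ β U₀ B₀ B Ψ₀ Ψ O`
(FinalEraPackage2.lean; by `Iff.rfl` the inline hypothesis of RadiativeLyapunovBudget) together with
(R) `RaysStayInClosure 𝒟 O`, (F) eventual future-orientation of every rest-frame hole chart on every
truncated slab {t*ᵢ = τ, rᵢ ≤ ρ} (push-forward of `Kerr.timeVector Mᵢ aᵢ` future-directed causal)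
and (F₀) eventual future-orientation of the flat chart beyond a fixed flat distance ϱ₀ from the
holes (push-forward of ∂₀): if the labels pairwise disperse (‖ξᵢ − ξⱼ‖ → ∞) then the re-typed
Statement's conclusion holds for that development — ∃ O′ and a C² FinalStateDecomposition d of O′
with sub-extremal holes, O′ = J⁺(ιX) ∩ I⁻(d.charted), RaysStayInClosure 𝒟 O′, HasExhaustiveCharts d
(HONEST radii Rᵢ(τ) → ∞, Rᵢ ≥ max(r₊,0)+1) and IsFutureOriented d. Content: Cesàro velocities vᵢ
(|vᵢ| ≤ V < 1, drift o(t)); pure boosts Λᵢ (orthochronous by construction) and charts Ψᵢ ∘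
(Λᵢ,cᵢ)⁻¹, for which (F) IS clause (ii) slab by slab; honest radii by a diagonal argument on the
effacement clause; flat chart restricted outside sublinear tubes of radius ≫ drift + ϱ₀ so that (F₀)
gives (iii); O′ ⊇ O by localisation + a J⁻-then-I⁻ push-up, so (R) passes to O′; exhaustion
transported through the boosts. Supersedes stmt-FinalStateConjecture-10994 (rev 2; notes transfer).
[deps: FinalEraGeneric] [difficulty: XL] (why it might fail: Package+dispersal may not yield Cesàro
velocities (κ-slack non-integrable for d~√t; momentum balance from Ric=0 unproved for N≥2,
Blanchet2024 is formal); O′ ⊇ O needs a J⁻/I⁻ push-up through d.charted; honest radii need a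
diagonal effacement argument.) [MarchalSaari1976, Blanchet2024, EinsteinInfeldHoffmann1938,
GiorgiKlainermanSzeftel2022, KlainermanSzeftel2023, DafermosHolzegelRodnianskiTaylor2021,
arXiv:2302.08916, Hintz2024GluingIII, DafermosLuk2017, arXiv:2601.01517, ONeill1983]
#4 FinalEraGeneric (crux) — PRE-PHASE, rev 3. For every connected Hausdorff second-countable
3-manifold X, TAME-Christodoulou-generically on admissibleVacuumData X (`IsTameChristodoulouGeneric
… 1`, the Statement's notion: witness families tame on ONE fixed end and immersed at 0), the datum
has an MGHD and every MGHD has complete 𝓘⁺ and a FINAL ERA: ∃ N, sub-extremal labels (Mᵢ,aᵢ), T, δ,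
V, C₁, C₂, ρ₀, κ, C² worldlines ξᵢ, slack β, U₀, B₀ = Minkowski.backgroundOn U₀, B i =
Kerr.background Mᵢ aᵢ, charts Ψ₀, Ψᵢ and O with `IsFinalEra₂ …` — the 31 rev-2 clauses (exterior
region; δ-floor; V-Lipschitz, V < 1; modulation law with 1PN slack κ and integrable β ≥ 0; late
charts into O; U₀ ⊇ {t > T} minus ρ₀-tubes; C² far-zone flatness beyond ϱ(ε); scale-covariant
near-zone pin ≤ 1/(100·Mᵢ^m), m ≤ 2, on {rᵢ ≤ 2ρ₀}; effacement; overlaps only inside range Ψ₀;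
two-sided localisation; clock comparison; exhaustion for every τ₁ > T; disjoint certified tubes; r₊
< ρ₀) — AND (R) every future-complete normalised null ray from Σ stays in closure O, (F) for every
i, ρ, eventually in τ, on {t*ᵢ = τ, rᵢ ≤ ρ} the push-forward dΨᵢ(V_{Mᵢ,aᵢ}), V = −g♯(dt*)
(`Kerr.timeVector`, timelike also in the ergoregion), is future-directed causal, (F₀) ∃ ϱ₀,
eventually in τ, on the flat slab {x⁰ = τ} ∩ U₀ at flat distance ≥ ϱ₀ from every ξᵢ(τ), dΨ₀(∂₀) is
future-directed causal (far zone only: the fixed-ρ₀ flat domain may meet ergoregions, where an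
honest ∂₀ is spacelike). Honest final eras satisfy (R), (F), (F₀) (rest-frame copies of the
Statement's own new conjuncts). Supersedes stmt-FinalStateConjecture-10992 (rev 2: topology-free
genericity, no (R)/(F)/(F₀)); all rev-2 notes on the 31 clauses apply verbatim. [difficulty:
open-problem] (why it might fail: Bundles weak cosmic censorship, finitely many mergers,
tight-cluster resolution, a black-hole EIH law with L¹ slack and SUB-extremal settling (third law
only generically, KehleUnger2025) — now for TAME witness families; (R) also fails if a
future-complete null ray hides inside a black hole.) [Christodoulou1999, Christodoulou2008,
DafermosLuk2017, EinsteinInfeldHoffmann1938, Blanchet2024, Hintz2024GluingIII, KehleUnger2025,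
KehleUnger2024, Penrose1982, arXiv:2304.08455, arXiv:0811.0354]
#9 DispersalFromBudget (support) — Pure real analysis (the "dissipative Marchal–Saari" skeleton the
typed Statement actually needs): N curves ξᵢ : ℝ → ℝ³ that are V-Lipschitz on [T,∞), and a function
E antitone on [T,∞), bounded below on [T,∞), with the coercivity "D-close throughout [t,t+1] ⇒
E(t+L) ≤ E(t) − ε(D)" for every D > 0, force ‖ξᵢ(t) − ξⱼ(t)‖ → ∞ for every i ≠ j. Proof: if lim inf
dᵢⱼ < ∞, infinitely many unit intervals are (D+2V+1)-close; thinning them to spacing ≥ L+1 and using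
antitonicity gives E(tₖ) ≤ E(t₀) − kε → −∞. [difficulty: provable-now; PROVED 2026-08-16,
Theorems/DissipativeFinalMotionsDispersalFromBudget.lean, p99650] [doi:10.1016/0022-0396(76)90101-7,
doi:10.2307/1995609, arXiv:1207.5001]

TWO-LAYER PLAN. RadiativeLyapunovBudget ⇐ BondiBudget (E := Bondi mass on flat-adapted cuts is
antitone, ≥ 0, ≤ M_ADM for these MGHDs) →
LoiteringRadiates (a D-close pair radiates ≥ ε(D) of Bondi energy within lag L(D), uniformly over
δ-separated, V-slow
configurations) → RadiativeLyapunovBudget. DispersingCapture ⇐ AsymptoticVelocities (dispersal ⇒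
Cesàro velocities, via
momentum/angular-momentum balance) → ZoneBookkeeping (boosted charts, growing certified zones,
sublinear tubes, exhaustion) →
DispersingCapture. FinalEraGeneric ⇐ PrePhase (generic data reach a δ-separated proto-Kerr era with
complete 𝓘⁺) →
BlackHoleEIH (the modulation law and chart localisation) → IsolatedCapture (effacement clause = Kerr
stability for
eventually-isolated holes, sub-extremal generically) → FinalEraGeneric. STRENGTHENING (not
load-bearing, the card's ODE
deliverable (3)): a dissipative Chazy–Marchal–Saari classification — under momentum/angular-momentum
balance in consequence
form, dispersing near-Newtonian systems separate at rates t or t^{2/3} with distinct cluster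
velocities — to be filed as a
support item once RadiativeLyapunovBudget's balance laws are fixed in form (naive "‖residual‖ ≤
ε₀·Newtonian" versions are FALSE:
torque-driven t^{1/2} out-spirals and 1/t centre-of-mass forcing are allowed by a norm bound alone).

KILL CRITERIA. A vacuum final era with an eternally recurrent D-close pair
(¬RadiativeLyapunovBudget: an eternal non-merging black-hole binary
or Sitnikov-type oscillation) closes the route `refuted:RadiativeLyapunovBudget` and is a ¬FSC-type
witness worth its own
negative route. A dispersing era that does not settle (hole without Cesàro velocity, or large-|a|
instability) refutes
DispersingCapture — pivot: restate with momentum-balance clauses added to the package, or close if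
the instability is real.
FinalEraGeneric refuted by a package-unsatisfiability argument on exact Kerr or on well-separated
data ⇒ misstatement: repair
by `--restate` (same decomposition); refuted by generic extremal-Kerr formation, generic naked
singularities or an infinite
merger cascade ⇒ close (the line, and FSC as typed, die together). FSC proved by a global route
(e.g. a quiet-window capture)
moots this one; DispersalFromBudget refuted would mean a Lean misformalisation only (fix and
re-file). The rev-3 clauses (R), (F), (F₀) are
rest-frame copies of the re-typed Statement's own new conjuncts (RaysStayInClosure,
IsFutureOriented): an honest era violating them
refutes the Statement's clause, not this line; a sign-convention slip in (F)/(F₀) would be a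
misstatement (one-token `--restate`).

NOT DECOMPOSED YET. The Bondi-mass witness for E (Cauchy-side ports exist — grounder g15-10:
`DataEmbedding.BondiFoliation`/`IsCanonical ⇒
bondiMass_antitone/nonneg/le_admEnergy` in BondiMassCauchy.lean, `bondiMass_antitoneOn (Ici
u₀)`/`hasDerivAt_bondiMass` in
BondiSachsRadiativeEnd.lean, `cutBondiMass` in CutBondiMass.lean; what is missing is the
radiative-end/canonical-foliation HYPOTHESIS for these
MGHDs and cuts adapted to the flat chart), a mass-normalised deviation helper (`truncDeviationCk` of
the Mᵢ-rescaled chart) that would let clause 22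
be stated through the prelude instead of the inline homogeneous seminorm, the quantitative loitering
floor and its all-multipole compactness argument, the balance laws
(linear and angular momentum with fluxes bounded by the energy flux), the rate classification t vs
t^{2/3}, horizon
normalisation of hole charts, and every constant of the pre-phase (δ in units of max Mᵢ, the 1/100
tolerance, 2ρ₀): all
layer-2 children or prover-side lemmas (`--supports`). Rev 3 adds no foreseen child: (F) transports
through the boosts as an identity
(`boostedKerrBackground` keeps the rest-frame t*ᵢ, rᵢ and the Statement's vector is Λᵢ V(Λᵢ⁻¹(x −
cᵢ))), (F₀) reaches the final flat slabs because
they recede from the holes, the ray clause passes from O to O′ ⊇ O by monotonicity of closure once O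
⊆ I⁻(d.charted) (J⁻-then-I⁻ push-up), and the
honest radii Rᵢ(τ) → ∞ come from a diagonal argument on the effacement clause — all prover-side
lemmas of DispersingCapture.

CHEAPEST FALSIFIER. (1) Package satisfiability on the exact sub-extremal Kerr MGHD (N = 1, ξ ≡ 0):
write down Ψ₁ = ingoing Kerr–Schild chart bent
logarithmically to the future at large r (so that {t* > T} ⊆ J⁺(ιX)), Ψ₀ = the same coordinates
restricted to {r > ρ₀}, and
check clauses (EX), (X2)–(X4), (H2) by hand; any clash is a misstatement of
FinalEraGeneric/DispersingCapture (repairable, but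
it breaks the route for 72 h). (2) For RadiativeLyapunovBudget: the rotating equal-mass equilateral
(Lagrange) configuration has
constant quadrupole tensor — confirm its octupole/current-quadrupole flux is non-zero (textbook PN
computation,
arXiv:1310.1528 §2); a rigidly moving finite point configuration with ALL radiative multipoles
constant would kill the
intended proof. (3) Lookup: is extremal Kerr formation from admissible vacuum data (arXiv:2211.15742
programme) expected to
be codimension ≥ 1? If not, FinalEraGeneric is false as typed. STATUS rev 2: (1) was run on paper by
the retriage planner and refuter rreview-0815T15-8-0 (evidence PhantomBinary_RLB_evidence.md on
stmt-10153): honest one-hole packages exist on Li–Mei-type collapse data (exact Kerr is not the MGHD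
of one-ended data), AND the check exposed the
junk that refuted rev-1 RadiativeLyapunovBudget on paper — a twin/phantom label sharing the real
hole's chart (Ψ₂ := Ψ₁, Kepler phantom ξ₂ = −ξ₁ or
static twin) met all 29 clauses and loitered forever. Rev 2 repairs the shared package (clauses
22/30/31). NEW CHEAPEST FALSIFIER (4): a phantom
label on a DIFFERENT chart — build, inside the radiation zone of an honest one-hole MGHD, an open
embedding of the Kerr(M₂,a₂) late exterior whose
certified shell {r₊ < r ≤ 2ρ₀} is within tolerance of Kerr: at C⁰ this IS possible (spacelike
Nash–Kuiper corrugation inside a Rindler wedge —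
why the C⁰-only clause 22 of rev 1 was floppy); rev 2 demands order-1,2 closeness 1/(100 M₂), 1/(100
M₂²), i.e. curvature equal to near-horizon
Kerr's at the 1 % level, which a nearly flat region cannot supply at any scale M₂ — confirm or break
this on paper (and check clauses 25–29 do not
let the flat chart dodge the real hole). (2), (3) not yet run. (5) rev 3, cheapest of all: on the
exact Schwarzschild/Kerr exterior with the identity chart
(cf. Theorems/SeamedChartsExhaust/Negative/ExactSchwarzschild*.lean), check that dΨ(V), V =
Kerr.timeVector M a = ∂₀ − 2H ℓ = −g♯(dt*), is
FUTURE-directed for the development's time orientation and that d(id)(∂₀) is future-directed far out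
— i.e. that (F)/(F₀) carry the sign the
Statement's IsFutureOriented carries (they are its rest-frame copies, so a clash would hit the
Statement too); a slip makes FinalEraGeneric
unsatisfiable and is a one-token repair.

NUMBERS. Items: 5 (3 cruxes, 1 support — DispersalFromBudget PROVED —, 1 assembly; rev 3 restated
FinalEraGeneric and DispersingCapture 1:1 and
re-filed the bookkeeping assembly in uncurried form X → Statement, the curried rev-2 item
stmt-FinalStateConjecture-10157 having been proved for rev 2 by
Theorems/DissipativeFinalMotionsAssembly.lean against the OLD Statement — `closes` is the deciding
theorem, D-0027 §2.1); package clauses: 31 (`IsFinalEra₂`) + 3 rev-3 clauses (R), (F), (F₀);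
explicit constants in the package:
near-zone tolerances 1/(100·Mᵢ^m) for derivative order m = 0, 1, 2 on {rᵢ ≤ 2ρ₀}, certified radius
2ρ₀ > 2r₊, speed bound V < 1. Scales the cruxes are measured against: modulation
slack of 1PN form κ(Mⱼ/d²)(v² + μ/d) (EIH 1938; arXiv:1310.1528), radiation reaction 2.5PN =
relative (μ/d)^{5/2}, Peters
inspiral time (5/256) d⁴/(μM²) (finite at every separation — why tight clusters cannot be eternal),
quadrupole luminosity
(1/5)⟨Q⃛ᵢⱼQ⃛ᵢⱼ⟩, conservative final motions xᵢ = Aᵢt + O(t^{2/3}) (Marchal–Saari 1976), Price tails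
t⁻³ (barrier
PriceLawTail: no rates are claimed anywhere in the route), Kerr stability proved for |a| ≪ M only
(GKS 2022).

DEFINITION REQUESTS. `FinalEraPackage₂` / `CauchyDevelopment.IsFinalEra₂` LANDED
(Literature/Geometry/Lorentzian/FinalEraPackage2.lean, item
defn-FinalEraPackage2; rev-1 companion FinalEraPackage.lean): rev 3 states FinalEraGeneric and
DispersingCapture through `IsFinalEra₂` (the gate's
signature-length cap forbids the inline 34-clause form) and the route file imports that module;
RadiativeLyapunovBudget keeps the rev-2 inline
package, which `IsFinalEra₂` equals by `Iff.rfl` (checked in Sketch.lean; dictionary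
`FinalEraPackage₂.forall_iff` / `nonempty_iff` for provers who
prefer the bundled structure). No Literature notion is missing for the statements as filed; a
`CauchyDevelopment`-based Bondi foliation/mass
(port of `BondiFoliation`) remains the natural cite/definition want for the layer-2 child
BondiBudget.

Novelty: Searches (2026-08-15): `lit search --source zbmath` for "Marchal Saari final evolution n-body" (1:
doi:10.1016/0022-0396(76)90101-7),
"Saari expanding gravitational systems" (doi:10.2307/1995609), "Pollard behaviour of gravitational
systems" (zbl:0159.26102),
"Margheri Ortega Rebelo dissipative Kepler" (zbl:1473.70028), "Kehle Unger extremal third law"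
(arXiv:2211.15742),
"Neugebauer Hennig two Kerr" (arXiv:0905.4179), "Hintz gluing small black holes" (arXiv:2306.07409,
2408.06712, 2408.06715),
"Einstein Infeld Hoffmann" (doi:10.2307/1968714), "Chazy oscillatory final motions"
(arXiv:2212.05684); `lit frontier
FinalStateConjecture --since 2020` (30 rows; relevant: arXiv:2601.01517 multi-black-hole Cauchy
data, arXiv:2409.14582);
`lit bridges FinalStateConjecture --cross any`; `lit galaxy search --star all` for "final evolution
of the n-body" (Marchal's
book panama:332147000868870; Hartree multisolitons with many-body law arXiv:2501.18398), "expanding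
gravitational systems"
(Saari CBMS 104, panama:470951753941050), "final state conjecture" (3+3 rows, none on N ≥ 2
dynamics); local `lit search`
index unavailable (searchd reset) — remote cascade used. In-tree: 0 routes on the summit, 60+ cards
read by title, the two
nearest (dissipation-budget-quiet-window-capture, no-parking-ernst-riemann-hilbert) read in full.
Nearest prior art found: Marchal–Saari doi:10.1016/0022-0396(76)90101-7 and Saari
doi:10.2307/1995609 (conservative final
evolutions / expanding systems); Margheri–Orteg  [refs: 10.1016/0022-0396(76, 10.2307/1995609, 10.2307/1968714, 2211.15742, 0905.4179, 2306.07409, 2212.05684, 2601.01517, 2409.14582, 2501.18398, 1207.5001, 0811.4596, 2408.06715, doi:10.1016/0022-0396, doi:10.2307/1995609, doi:10.2307/1968714]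

Barriers (technique_class: modulation-equations, dissipation-budget, final-motions): - technique_class: modulation-equations, dissipation-budget, celestial-mechanics-final-motions,
capture-by-stability
- Literature.Barriers.FinalStateConjecture.PriceLawTail: evaded — no item asserts a rate; tails
enter only the integrable slack β of the modulation law and the lag L(D) of the budget; convergence
clauses are rate-free `Tendsto`/`∀ε∃T` statements exactly as in the Statement.
- Literature.Barriers.FinalStateConjecture.WaveCoordinatesNullConditionFailure: evaded — no
small-data iteration in wave coordinates is claimed; the far zone is in consequence form (flat chart
converging in C² beyond ϱ(ε)), where the logarithmic drifts of harmonic gauge are absorbed by the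
chart freedom and the sublinear tubes.
- Literature.Barriers.FinalStateConjecture.SlowlyRotatingKerrFrontier: it does not evade it; the bet
is that capture of eventually-isolated / dispersing holes (effacement clause of FinalEraGeneric,
DispersingCapture) extends to the full sub-extremal range via real-axis mode stability
(arXiv:2302.08916) inside the GKS scheme — inherited by every route on this summit.
- Literature.Barriers.FinalStateConjecture.KerrSuperradiance: the budget E is the Bondi mass at 𝓘⁺
(monotone by mass loss), not a T- or (T+ΩΦ)-energy on the exterior, so the indefinite sign of the
Killing energy in the ergoregion never enters; superradiant amplification is paid for by the holes'
rotational energy, which the consequence-form budget does not need to track.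
- Literature.Barriers.FinalStateCon

History (route lifecycle, newest last):
- 2026-08-15T16:35:11Z · rev 2: restated FinalEraGeneric (stmt-FinalStateConjecture-10155), RadiativeLyapunovBudget (stmt-FinalStateConjecture-10153), DispersingCapture (stmt-FinalStateConjecture-10154) — cone-repair + misstated-repair (planner rrepair g2). CONE: the 3 unproved facts in the module import cone are the @[deprecated] refuted/mis- (planner-rrepair-FinalStateConjecture-Dissipati-fb299476-g2-0)
- 2026-08-16T23:25:10Z · rev 3: restated FinalEraGeneric (stmt-FinalStateConjecture-10992), DispersingCapture (stmt-FinalStateConjecture-10994), Assembly (stmt-FinalStateConjecture-10157 proved) — route-repair rev 3 (statement re-type T2, p126844): restated FinalEraGeneric (tame genericity IsTameChristodoulouGeneric on one fixed end; package v (planner-rrepair-FinalStateConjecture-Dissipati-d79c15f6-0)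
- 2026-08-24T22:42:23Z · DORMANT — reconciler: no traction for 7.1 d (last activity item-evidence-added at 2026-08-17T18:53:21Z); parked, not closed — `ledger route dormant route-FinalStateConjec (operator:999:1388403)

sub-problem: FinalStateConjecture · status: dormant · opened planner-plancard-FinalStateConjecture-FinalSt-9e325eb7-0 2026-08-15T15:14:51Z · rev 4 · ledger route-FinalStateConjecture-DissipativeFinalMotions
GENERATED by the gate from the ledger (D-0016/17). Provers cite these decls: `theorem foo : Summit.FinalStateConjecture.FinalStateConjecture.Theses.DissipativeFinalMotions.<Decl> := …` in Summits/FinalStateConjecture/FinalStateConjecture/Theorems/<Name>.lean.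
-/

namespace Summit.FinalStateConjecture.FinalStateConjecture.Theses.DissipativeFinalMotions

open scoped BigOperators Topology Manifold Classical MeasureTheory ProbabilityTheory Matrix InnerProductSpace ComplexConjugate ContinuousMap
open Filter Set Function TopologicalSpace MeasureTheory

attribute [summit_statement] _root_.FinalStateConjecture

-- earlier RadiativeLyapunovBudget (stmt-FinalStateConjecture-10153, replaced 2026-08-15T16:35:11Z -> stmt-FinalStateConjecture-10993): retired by None — ∀ (X : Type) [TopologicalSpace X] [ChartedSpace (EuclideanSpace ℝ (Fin 3)) X] [IsManifold (𝓡 3) ((⊤ : ℕ∞) : WithTop ℕ∞) X] [T2Space X] [SecondCountableTopology X] [ConnectedSpace X], ∀ (D : Literature.Geometry.Lorentzian.InitialDataSet (𝓡 3) X), D ∈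
/-- item stmt-FinalStateConjecture-10993 · crux · rank 2 · open · by planner
why it might fail: Needs Bondi-mass loss+positivity over CauchyDevelopment and a UNIFORM all-multipole floor ε(D) for distinct loitering holes (none in print); and a phantom label might still satisfy clauses 22/30/31 (e.g. huge-mass fake zone by long-wave spacelike corrugation) ⇒ misstated again.
sources: ChristodoulouKlainerman1993PMS41, arXiv:gr-qc/0307109, SchoenYau1982, Blanchet2024, arXiv:0905.4179, AlexakisSchlue2018
[crux] For admissible data, a maximal vacuum Cauchy development with complete 𝓘⁺, and ANY final-era
package (the 31 conjuncts of FinalEraGeneric rev 2: clauses 1–21 and 23–29 as at open; clause 22 is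
now the SCALE-COVARIANT near-zone pin — for m ≤ 2 the order-m coordinate derivatives of Ψᵢ*g −
g_{Mᵢ,aᵢ} on the certified slabs {t*ᵢ = τ, rᵢ ≤ 2ρ₀}, τ ≥ T, are ≤ 1/(100·Mᵢ^m) (C⁰ tolerance 1/100
as before, C¹ and C² in the label's own mass unit, so curvature is pinned to Kerr(Mᵢ,aᵢ)'s at the 1
% level near r₊ and a chart into a nearly flat region cannot pose as a near zone); clause 30: the
certified tubes Ψᵢ({t*ᵢ > T, rᵢ ≤ 2ρ₀}) are pairwise DISJOINT (distinct labels are distinct holes —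
kills the twin/phantom-binary witness of rev 1); clause 31: r₊(Mᵢ,aᵢ) < ρ₀ (certified zones are
non-degenerate shells reaching from the horizon past 2r₊), all taken as hypotheses), there is E : ℝ
→ ℝ, antitone on [T,∞) and bounded below there, such that for every D > 0 there are ε > 0 and a lag
L ≥ 0 with E(t+L) ≤ E(t) − ε whenever two distinct labels satisfy ‖ξᵢ(s) − ξⱼ(s)‖ ≤ D for all s ∈
[t, t+1] (t ≥ T). Intended witness: the Bondi mass along cuts adapted to the flat chart (mass loss +
positivity; -/
@[route_item "route-FinalStateConjecture-DissipativeFinalMotions", crux]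
def RadiativeLyapunovBudget : Prop :=
  ∀ (X : Type) [TopologicalSpace X] [ChartedSpace (EuclideanSpace ℝ (Fin 3)) X] [IsManifold (𝓡 3) ((⊤ : ℕ∞) : WithTop ℕ∞) X] [T2Space X] [SecondCountableTopology X] [ConnectedSpace X], ∀ (D : Literature.Geometry.Lorentzian.InitialDataSet (𝓡 3) X), D ∈ Literature.Geometry.Lorentzian.admissibleVacuumData X → ∀ (𝒟 : Literature.Geometry.Lorentzian.VacuumCauchyDevelopment D), 𝒟.IsMaximal → Summit.FinalStateConjecture.HasCompleteNullInfinity 𝒟.toCauchyDevelopment → ∀ (N : ℕ) (M a : Fin N → ℝ) (T δ V C₁ C₂ ρ₀ κ : ℝ) (ξ : Fin N → ℝ → EuclideanSpace ℝ (Fin 3)) (β : ℝ → ℝ) (U₀ : Opens Literature.Geometry.Lorentzian.E4) (B₀ : Literature.Geometry.Lorentzian.ModelBackground) (B : Fin N → Literature.Geometry.Lorentzian.ModelBackground) (Ψ₀ : B₀.domain → 𝒟.carrier) (Ψ : (i : Fin N) → (B i).domain → 𝒟.carrier) (O : Set 𝒟.carrier), O = Summit.FinalStateConjecture.exteriorOf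 𝒟.toCauchyDevelopment (Ψ₀ '' B₀.lateRegion T ∪ ⋃ i, Ψ i '' (B i).lateRegion T) ∧ B₀ = Literature.Geometry.Lorentzian.Minkowski.backgroundOn U₀ ∧ (B = fun i ↦ Literature.Geometry.Lorentzian.Kerr.background (M i) (a i)) ∧ (∀ i, Literature.Geometry.Lorentzian.Kerr.IsSubextremal (M i) (a i)) ∧ 0 < δ ∧ 0 ≤ V ∧ V < 1 ∧ 0 ≤ C₁ ∧ 1 ≤ C₂ ∧ 0 < ρ₀ ∧ 0 ≤ κ ∧ (∀ i, ContDiff ℝ 2 (ξ i)) ∧ (∀ t, T ≤ t → ∀ i j, i ≠ j → δ ≤ ‖ξ i t - ξ j t‖) ∧ (∀ i s t, T ≤ s → s ≤ t → ‖ξ i t - ξ i s‖ ≤ V * (t - s)) ∧ IntegrableOn β (Ici T) ∧ (∀ t, T ≤ t → 0 ≤ β t) ∧ (∀ t, T ≤ t → ∀ i, ‖deriv (deriv (ξ i)) t + ∑ j ∈ Finset.univ.erase i, (M j / ‖ξ i t - ξ j t‖ ^ 3) • (ξ i t - ξ j t)‖ ≤ κ * (∑ j ∈ Finset.univ.erase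 i, M j / ‖ξ i t - ξ j t‖ ^ 2 * (‖deriv (ξ i) t‖ ^ 2 + ‖deriv (ξ j) t‖ ^ 2 + (∑ l, M l) / ‖ξ i t - ξ j t‖)) + β t) ∧ 𝒟.toSpacetime.IsLateChart B₀ O T Ψ₀ ∧ {y : Literature.Geometry.Lorentzian.E4 | T < y 0 ∧ ∀ i, ρ₀ < ‖Literature.Geometry.Lorentzian.E4.spatial y - ξ i (y 0)‖} ⊆ (B₀.domain : Set Literature.Geometry.Lorentzian.E4) ∧ (∀ ε : ℝ, 0 < ε → ∃ ϱ T' : ℝ, ∀ τ, T' ≤ τ → Literature.Geometry.Lorentzian.supCkENorm (Subtype.val '' {y : B₀.domain | y.1 0 = τ ∧ ∀ i, ϱ ≤ ‖Literature.Geometry.Lorentzian.E4.spatial y.1 - ξ i τ‖}) 2 (𝒟.toSpacetime.deviationExtend B₀ Ψ₀) ≤ ENNReal.ofReal ε) ∧ (∀ i, 𝒟.toSpacetime.IsLateChart (B i) O T (Ψ i)) ∧ (∀ i (m : ℕ) (x : (B i).domain), m ≤ 2 → T ≤ x.1 0 → (B i).radius x.1 ≤ 2 * ρ₀ → ‖iteratedFDeriv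 ℝ m (𝒟.toSpacetime.deviationExtend (B i) (Ψ i)) x.1‖ ≤ 1 / (100 * M i ^ m)) ∧ (∀ i (R ε : ℝ), 0 < ε → ∃ D' : ℝ, ∀ T' : ℝ, (∀ t, T' ≤ t → ∀ j, j ≠ i → D' ≤ ‖ξ i t - ξ j t‖) → ∃ T'' : ℝ, ∀ τ, T'' ≤ τ → 𝒟.toSpacetime.truncDeviationCk (B i) (Ψ i) 2 R τ ≤ ENNReal.ofReal ε) ∧ (∀ i j, i ≠ j → Ψ i '' (B i).lateRegion T ∩ Ψ j '' (B j).lateRegion T ⊆ range Ψ₀) ∧ (∀ i (x : (B i).domain) (y : B₀.domain), T < x.1 0 → Ψ i x = Ψ₀ y → ‖Literature.Geometry.Lorentzian.E4.spatial y.1 - ξ i (y.1 0)‖ ≤ C₂ * (B i).radius x.1 + C₁) ∧ (∀ i (R : ℝ), ∃ T₃ : ℝ, ∀ y : B₀.domain, T₃ < y.1 0 → ‖Literature.Geometry.Lorentzian.E4.spatial y.1 - ξ i (y.1 0)‖ ≤ R → ∃ x : (B i).domain, Ψ i x = Ψ₀ y ∧ T < x.1 0 ∧ (B i).radius x.1 ≤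 C₂ * R + C₁) ∧ (∀ i (t₀ : ℝ), ∃ τ' : ℝ, Ψ i '' (B i).lateRegion τ' ∩ Ψ₀ '' {y : B₀.domain | y.1 0 ≤ t₀} = ∅) ∧ (∀ i (τ' R : ℝ), ∃ t₀ : ℝ, Ψ₀ '' {y : B₀.domain | t₀ < y.1 0} ∩ Ψ i '' {x : (B i).domain | x.1 0 ≤ τ' ∧ (B i).radius x.1 ≤ R} = ∅) ∧ (∀ τ₁, T < τ₁ → O \ (Ψ₀ '' B₀.lateRegion τ₁ ∪ ⋃ i, Ψ i '' (B i).truncLateRegion τ₁ (2 * ρ₀)) ⊆ 𝒟.toSpacetime.metric.causalPast 𝒟.toSpacetime.timeOrientation (Ψ₀ '' B₀.timeSlab τ₁ ∪ ⋃ i, Ψ i '' (B i).truncTimeSlab (2 * ρ₀) τ₁)) ∧ Pairwise (Disjoint on fun i ↦ Ψ i '' (B i).truncLateRegion T (2 * ρ₀)) ∧ (∀ i, Literature.Geometry.Lorentzian.Kerr.rPlus (M i) (a i) < ρ₀) → ∃ E : ℝ → ℝ, AntitoneOn E (Ici T) ∧ BddBelow (E '' Ici T) ∧ (∀ D' : ℝ,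 0 < D' → ∃ ε L : ℝ, 0 < ε ∧ 0 ≤ L ∧ ∀ t, T ≤ t → ∀ i j, i ≠ j → (∀ s, t ≤ s → s ≤ t + 1 → ‖ξ i s - ξ j s‖ ≤ D') → E (t + L) ≤ E t - ε)

-- earlier DispersingCapture (stmt-FinalStateConjecture-10154, replaced 2026-08-15T16:35:11Z -> stmt-FinalStateConjecture-10994): retired by None — ∀ (X : Type) [TopologicalSpace X] [ChartedSpace (EuclideanSpace ℝ (Fin 3)) X] [IsManifold (𝓡 3) ((⊤ : ℕ∞) : WithTop ℕ∞) X] [T2Space X] [SecondCountableTopology X] [ConnectedSpace X], ∀ (D : Literature.Geometry.Lorentzian.InitialDataSet (𝓡 3) X), D ∈ Liter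
-- earlier DispersingCapture (stmt-FinalStateConjecture-10994, replaced 2026-08-16T23:25:10Z -> stmt-FinalStateConjecture-17643): retired by None — ∀ (X : Type) [TopologicalSpace X] [ChartedSpace (EuclideanSpace ℝ (Fin 3)) X] [IsManifold (𝓡 3) ((⊤ : ℕ∞) : WithTop ℕ∞) X] [T2Space X] [SecondCountableTopology X] [ConnectedSpace X], ∀ (D : Literature.Geometry.Lorentzian.InitialDataSet (𝓡 3) X), D ∈ Liter
/-- item stmt-FinalStateConjecture-17643 · crux · rank 3 · open · by planner
why it might fail: Package+dispersal may not yield Cesàro velocities (κ-slack non-integrable for d~√t; momentum balance from Ric=0 unproved for N≥2, Blanchet2024 is formal); O′ ⊇ O needs a J⁻/I⁻ push-up through d.charted; honest radii need a diagonal effacement argument.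
sources: MarchalSaari1976, Blanchet2024, EinsteinInfeldHoffmann1938, GiorgiKlainermanSzeftel2022, KlainermanSzeftel2023, DafermosHolzegelRodnianskiTaylor2021
[crux] rev 3 (statement re-type T2, p126844). For admissible data, a maximal vacuum Cauchy
development with complete 𝓘⁺, and binders N, (Mᵢ,aᵢ), T, δ, V, C₁, C₂, ρ₀, κ, ξ, β, U₀, B₀, B, Ψ₀,
Ψ, O satisfying the 31-clause rev-2 final-era package `𝒟.toCauchyDevelopment.IsFinalEra₂ N M a T δ V
C₁ C₂ ρ₀ κ ξ β U₀ B₀ B Ψ₀ Ψ O` (FinalEraPackage2.lean; by `Iff.rfl` the inline hypothesis of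
RadiativeLyapunovBudget: exterior region, sub-extremal labels, δ-floor, V-Lipschitz worldlines,
modulation law with 1PN slack, late charts, C² far-zone flatness, scale-covariant near-zone pin on
{rᵢ ≤ 2ρ₀}, effacement, overlap/localisation/clock clauses, exhaustion, disjoint certified tubes, r₊
< ρ₀), TOGETHER WITH (R) `RaysStayInClosure 𝒟 O`, (F) eventual future-orientation of every
rest-frame hole chart on every truncated slab {t*ᵢ = τ, rᵢ ≤ ρ} (push-forward of `Kerr.timeVector Mᵢ
aᵢ` future-directed causal) and (F₀) eventual future-orientation of the flat chart beyond some fixed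
flat distance ϱ₀ from the holes (push-forward of ∂₀ future-directed causal): IF the labels pairwise
disperse in the flat chart (‖ξᵢ(t) − ξⱼ(t)‖ → ∞, i ≠ j) THEN the conclusion of the re-typed
Statement holds for that developmen -/
@[route_item "route-FinalStateConjecture-DissipativeFinalMotions", crux]
def DispersingCapture : Prop :=
  ∀ (X : Type) [TopologicalSpace X] [ChartedSpace (EuclideanSpace ℝ (Fin 3)) X] [IsManifold (𝓡 3) ((⊤ : ℕ∞) : WithTop ℕ∞) X] [T2Space X] [SecondCountableTopology X] [ConnectedSpace X], ∀ (D : Literature.Geometry.Lorentzian.InitialDataSet (𝓡 3) X), D ∈ Literature.Geometry.Lorentzian.admissibleVacuumData X → ∀ (𝒟 : Literature.Geometry.Lorentzian.VacuumCauchyDevelopment D), 𝒟.IsMaximal → Summit.FinalStateConjecture.HasCompleteNullInfinity 𝒟.toCauchyDevelopment → ∀ (N : ℕ) (M a : Fin N → ℝ) (T δ V C₁ C₂ ρ₀ κ : ℝ) (ξ : Fin N → ℝ → EuclideanSpace ℝ (Fin 3)) (β : ℝ → ℝ) (U₀ : Opens Literature.Geometry.Lorentzian.E4) (B₀ : Literature.Geometry.Lorentzian.ModelBackground)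 (B : Fin N → Literature.Geometry.Lorentzian.ModelBackground) (Ψ₀ : B₀.domain → 𝒟.carrier) (Ψ : (i : Fin N) → (B i).domain → 𝒟.carrier) (O : Set 𝒟.carrier), 𝒟.toCauchyDevelopment.IsFinalEra₂ N M a T δ V C₁ C₂ ρ₀ κ ξ β U₀ B₀ B Ψ₀ Ψ O → Summit.FinalStateConjecture.RaysStayInClosure 𝒟.toCauchyDevelopment O → (∀ i (ρ : ℝ), ∀ᶠ τ in atTop, ∀ x ∈ (B i).truncTimeSlab ρ τ, 𝒟.toSpacetime.timeOrientation.IsFutureDirected (mfderiv 𝓘(ℝ, Literature.Geometry.Lorentzian.E4) (𝓡 4) (Ψ i) x (Literature.Geometry.Lorentzian.Kerr.timeVector (M i) (a i) x.1))) → (∃ ϱ₀ : ℝ, ∀ᶠ τ in atTop, ∀ x ∈ B₀.timeSlab τ, (∀ i, ϱ₀ ≤ ‖Literature.Geometry.Lorentzian.E4.spatial x.1 - ξ i τ‖) → 𝒟.toSpacetime.timeOrientation.IsFutureDirected (mfderiv 𝓘(ℝ, Literature.Geometry.Lorentzian.E4) (𝓡 4) Ψ₀ x (Literature.Geometry.Lorentzian.E4.basisVector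 0))) → (∀ i j, i ≠ j → Tendsto (fun t ↦ ‖ξ i t - ξ j t‖) atTop atTop) → ∃ (O' : Set 𝒟.carrier) (d : Literature.Geometry.Lorentzian.FinalStateDecomposition 𝒟.toSpacetime O' 2), (∀ i, Literature.Geometry.Lorentzian.Kerr.IsSubextremal (d.mass i) (d.spin i)) ∧ O' = Summit.FinalStateConjecture.exteriorOf 𝒟.toCauchyDevelopment d.charted ∧ Summit.FinalStateConjecture.RaysStayInClosure 𝒟.toCauchyDevelopment O' ∧ Summit.FinalStateConjecture.HasExhaustiveCharts d ∧ Summit.FinalStateConjecture.IsFutureOriented d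

-- earlier FinalEraGeneric (stmt-FinalStateConjecture-10155, replaced 2026-08-15T16:35:11Z -> stmt-FinalStateConjecture-10992): retired by None — ∀ (X : Type) [TopologicalSpace X] [ChartedSpace (EuclideanSpace ℝ (Fin 3)) X] [IsManifold (𝓡 3) ((⊤ : ℕ∞) : WithTop ℕ∞) X] [T2Space X] [SecondCountableTopology X] [ConnectedSpace X], Literature.Geometry.Lorentzian.InitialDataSet.IsChristodoulouGeneric (Lite
-- earlier FinalEraGeneric (stmt-FinalStateConjecture-10992, replaced 2026-08-16T23:25:10Z -> stmt-FinalStateConjecture-17642): retired by None — ∀ (X : Type) [TopologicalSpace X] [ChartedSpace (EuclideanSpace ℝ (Fin 3)) X] [IsManifold (𝓡 3) ((⊤ : ℕ∞) : WithTop ℕ∞) X] [T2Space X] [SecondCountableTopology X] [ConnectedSpace X], Literature.Geometry.Lorentzian.InitialDataSet.IsChristodoulouGeneric (Lite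
/-- item stmt-FinalStateConjecture-17642 · crux · rank 4 · open · by planner
why it might fail: Bundles weak cosmic censorship, finitely many mergers, tight-cluster resolution, a black-hole EIH law with L¹ slack and SUB-extremal settling (third law only generically, KehleUnger2025) — now for TAME witness families; (R) also fails if a future-complete null ray hides inside a black hole.
sources: Christodoulou1999, Christodoulou2008, DafermosLuk2017, EinsteinInfeldHoffmann1938, Blanchet2024, Hintz2024GluingIII
[crux] PRE-PHASE, rev 3 (statement re-type T2, p126844; card item (5) "imported", made explicit and
typed). For every connected Hausdorff second-countable 3-manifold X, TAME-Christodoulou-generically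
on admissibleVacuumData X (`IsTameChristodoulouGeneric … 1`, exactly the Statement's notion: through
every exceptional datum passes an injective one-parameter family of admissible data, tame on ONE
fixed asymptotically flat end — DR rates, continuous mass, wDist-continuous at 0 — and immersed at
0, all of whose other members are good), the datum has an MGHD and every MGHD has complete 𝓘⁺ and a
FINAL ERA: binders N, labels (Mᵢ,aᵢ), constants T, δ, V, C₁, C₂, ρ₀, κ, C² worldlines ξᵢ, slack β,
U₀, backgrounds B₀ (= Minkowski.backgroundOn U₀) and B i (= Kerr.background Mᵢ aᵢ), charts Ψ₀, Ψᵢ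
and the region O with (a) `𝒟.toCauchyDevelopment.IsFinalEra₂ N M a T δ V C₁ C₂ ρ₀ κ ξ β U₀ B₀ B Ψ₀ Ψ
O` — the 31-clause rev-2 package, verbatim the inline hypothesis of RadiativeLyapunovBudget with
`exteriorOf` unfolded (Literature/Geometry/Lorentzian/FinalEraPackage2.lean, `Iff.rfl`; dictionary
`FinalEraPackage₂.nonempty_iff/forall_iff`): O = J⁺(ιX) ∩ I⁻(charted late sets); sub-extremal
labels; δ-floor -/
@[route_item "route-FinalStateConjecture-DissipativeFinalMotions", crux]
def FinalEraGeneric : Prop :=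
  ∀ (X : Type) [TopologicalSpace X] [ChartedSpace (EuclideanSpace ℝ (Fin 3)) X] [IsManifold (𝓡 3) ((⊤ : ℕ∞) : WithTop ℕ∞) X] [T2Space X] [SecondCountableTopology X] [ConnectedSpace X], Literature.Geometry.Lorentzian.InitialDataSet.IsTameChristodoulouGeneric (Literature.Geometry.Lorentzian.admissibleVacuumData X) (fun D ↦ (∃ 𝒟 : Literature.Geometry.Lorentzian.VacuumCauchyDevelopment D, 𝒟.IsMaximal) ∧ ∀ 𝒟 : Literature.Geometry.Lorentzian.VacuumCauchyDevelopment D, 𝒟.IsMaximal → Summit.FinalStateConjecture.HasCompleteNullInfinity 𝒟.toCauchyDevelopment ∧ ∃ (N : ℕ) (M a : Fin N → ℝ) (T δ V C₁ C₂ ρ₀ κ : ℝ) (ξ : Fin N → ℝ → EuclideanSpace ℝ (Fin 3)) (β : ℝ → ℝ) (U₀ : Opens Literature.Geometry.Lorentzian.E4) (B₀ : Literature.Geometry.Lorentzian.ModelBackground) (B : Fin N → Literature.Geometry.Lorentzian.ModelBackground) (Ψ₀ : B₀.domain → 𝒟.carrier) (Ψ : (i : Fin N) → (B i).domain → 𝒟.carrier)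 (O : Set 𝒟.carrier), 𝒟.toCauchyDevelopment.IsFinalEra₂ N M a T δ V C₁ C₂ ρ₀ κ ξ β U₀ B₀ B Ψ₀ Ψ O ∧ Summit.FinalStateConjecture.RaysStayInClosure 𝒟.toCauchyDevelopment O ∧ (∀ i (ρ : ℝ), ∀ᶠ τ in atTop, ∀ x ∈ (B i).truncTimeSlab ρ τ, 𝒟.toSpacetime.timeOrientation.IsFutureDirected (mfderiv 𝓘(ℝ, Literature.Geometry.Lorentzian.E4) (𝓡 4) (Ψ i) x (Literature.Geometry.Lorentzian.Kerr.timeVector (M i) (a i) x.1))) ∧ (∃ ϱ₀ : ℝ, ∀ᶠ τ in atTop, ∀ x ∈ B₀.timeSlab τ, (∀ i, ϱ₀ ≤ ‖Literature.Geometry.Lorentzian.E4.spatial x.1 - ξ i τ‖) → 𝒟.toSpacetime.timeOrientation.IsFutureDirected (mfderiv 𝓘(ℝ, Literature.Geometry.Lorentzian.E4) (𝓡 4) Ψ₀ x (Literature.Geometry.Lorentzian.E4.basisVector 0)))) 1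

/-- item stmt-FinalStateConjecture-10156 · support · rank 9 · closed · proved by Summit.FinalStateConjecture.FinalStateConjecture.Theorems.DispersalFromBudget_proof @ 01abd5044f03 (prover) · by planner
sources: MarchalSaari1976, doi:10.2307/1995609, arXiv:1207.5001
[support] Pure real analysis (the "dissipative Marchal–Saari" skeleton the typed Statement actually
needs): N curves ξᵢ : ℝ → ℝ³ that are V-Lipschitz on [T,∞), and a function E antitone on [T,∞),
bounded below on [T,∞), with the coercivity "D-close throughout [t,t+1] ⇒ E(t+L) ≤ E(t) − ε(D)" for
every D > 0, force ‖ξᵢ(t) − ξⱼ(t)‖ → ∞ for every i ≠ j. Proof: if lim inf dᵢⱼ < ∞, infinitely many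
unit intervals are (D+2V+1)-close; thinning them to spacing ≥ L+1 and using antitonicity gives E(tₖ)
≤ E(t₀) − kε → −∞. [difficulty: provable-now] -/
@[route_item "route-FinalStateConjecture-DissipativeFinalMotions"]
def DispersalFromBudget : Prop :=
  ∀ (N : ℕ) (T V : ℝ) (ξ : Fin N → ℝ → EuclideanSpace ℝ (Fin 3)) (E : ℝ → ℝ), (∀ i s t, T ≤ s → s ≤ t → ‖ξ i t - ξ i s‖ ≤ V * (t - s)) → AntitoneOn E (Ici T) → BddBelow (E '' Ici T) → (∀ D' : ℝ, 0 < D' → ∃ ε L : ℝ, 0 < ε ∧ 0 ≤ L ∧ ∀ t, T ≤ t → ∀ i j, i ≠ j → (∀ s, t ≤ s → s ≤ t + 1 → ‖ξ i s - ξ j s‖ ≤ D') → E (t + L) ≤ E t - ε) → (∀ i j, i ≠ j → Tendsto (fun t ↦ ‖ξ i t - ξ j t‖) atTop atTop)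

-- earlier Assembly (stmt-FinalStateConjecture-10157, replaced 2026-08-16T23:25:10Z -> stmt-FinalStateConjecture-17644): proved by Summit.FinalStateConjecture.FinalStateConjecture.Theorems.DissipativeFinalMotions.assembly_proof — FinalEraGeneric → RadiativeLyapunovBudget → DispersalFromBudget → DispersingCapture → FinalStateConjecture
/-- item stmt-FinalStateConjecture-17644 · assembly · rank 1 · closed · proved by Summit.FinalStateConjecture.FinalStateConjecture.Theorems.DissipativeFinalMotions.assemblyT2_frame_proof (prover) · by planner
sources: Christodoulou1999, DafermosLuk2017
[assembly] frame statement X → Statement with X = FinalEraGeneric ∧ RadiativeLyapunovBudget ∧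
DispersalFromBudget ∧ DispersingCapture (the thesis): pure logic — tame Christodoulou genericity
`IsTameChristodoulouGeneric 𝓓 P 1` is monotone in P under pointwise implication on 𝓓, and pointwise
the rev-3 final-era package of FinalEraGeneric feeds RadiativeLyapunovBudget (budget E), the budget
+ the Lipschitz clause feed DispersalFromBudget (dispersal), and package + (R), (F), (F₀) +
dispersal feed DispersingCapture, whose conclusion is verbatim the re-typed Statement's; i.e.
literally the UNCURRIED deciding theorem `closes` of this file (proof `fun h ↦ closes h.1 h.2.1
h.2.2.1 h.2.2.2`, rc 0 in the planner's Sketch.lean). Rev 3 (route-repair after the statement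
re-type T2, p126844) replaces the curried form stmt-FinalStateConjecture-10157 (proved for rev 2 by
Theorems/DissipativeFinalMotionsAssembly.lean with the rev-2 bodies inlined against the OLD
Statement), whose `Assembly_holds` link the gate cannot render after the re-type. PROVERS: nothing
is gained by closing this bookkeeping item — `closes` already carries the proof; work the cruxes. If
you do close it, do so ONLY from a module -/
@[route_item "route-FinalStateConjecture-DissipativeFinalMotions"]
def Assembly : Prop :=
  FinalEraGeneric ∧ RadiativeLyapunovBudget ∧ DispersalFromBudget ∧ DispersingCapture → FinalStateConjecture

/-- `Assembly` holds: proved by `Summit.FinalStateConjecture.FinalStateConjecture.Theorems.DissipativeFinalMotions.assemblyT2_frame_proof`. -/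
theorem Assembly_holds : Assembly := _root_.Summit.FinalStateConjecture.FinalStateConjecture.Theorems.DissipativeFinalMotions.assemblyT2_frame_proof

/-! D-0027 §2.1 — DECIDING THEOREM (planner-authored via `route open/edit --closes-file`; by planner-rbadge-FinalStateConjecture-Dissipativ-fb299476-0 2026-08-16T23:48:13Z):
its hypotheses are this route's items and its conclusion the sub-problem Statement (glue_lint), and it elaborates with this file. -/

@[closes "route-FinalStateConjecture-DissipativeFinalMotions"] theorem closes (h₃ : FinalEraGeneric) (h₁ : RadiativeLyapunovBudget) (h₄ : DispersingCapture) :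
    FinalStateConjecture := by
  -- The support item `DispersalFromBudget` (stmt-FinalStateConjecture-10156) is PROVED
  -- (Theorems/DissipativeFinalMotionsDispersalFromBudget.lean, `DispersalFromBudget_proof` @ 01abd5044f03),
  -- but that module imports this one, so its `_holds` link cannot be rendered here (import cycle).
  -- Its landed proof — pure real analysis — is replayed verbatim, so that `closes` rests on the
  -- three CRUXES alone (human ruling 2026-08-16: only crux items are hypotheses of `closes`).
  have h₂ : DispersalFromBudget := by
    intro N T V ξ E hLip hanti hbdd hcoer i j hij
    by_contra hnot
    rw [Filter.tendsto_atTop_atTop] at hnot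
    push Not at hnot
    obtain ⟨D, hD⟩ := hnot
    obtain ⟨ε, L, hε, hL, hc⟩ := hcoer (|D| + 2 * |V| + 1) (by positivity)
    have hne : (E '' Ici T).Nonempty := ⟨E T, T, le_refl T, rfl⟩
    have hlt : sInf (E '' Ici T) < sInf (E '' Ici T) + ε := by linarith
    obtain ⟨y, ⟨t₁, ht₁, rfl⟩, hy⟩ := exists_lt_of_csInf_lt hne hlt
    obtain ⟨a, ha, hfa⟩ := hD (max t₁ T)
    have hat₁ : t₁ ≤ a := le_trans (le_max_left _ _) ha
    have haT : T ≤ a := le_trans (le_max_right _ _) ha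
    have hclose : ∀ s, a ≤ s → s ≤ a + 1 → ‖ξ i s - ξ j s‖ ≤ |D| + 2 * |V| + 1 := by
      intro s has hsa
      have h1 : ‖ξ i s - ξ i a‖ ≤ V * (s - a) := hLip i a s haT has
      have h2 : ‖ξ j s - ξ j a‖ ≤ V * (s - a) := hLip j a s haT has
      have h3 : V * (s - a) ≤ |V| := by
        calc V * (s - a) ≤ |V| * (s - a) :=
              mul_le_mul_of_nonneg_right (le_abs_self V) (by linarith)
          _ ≤ |V| * 1 := mul_le_mul_of_nonneg_left (by linarith) (abs_nonneg V)
          _ = |V| := mul_one _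
      have h4 : ‖ξ i a - ξ j a‖ ≤ |D| := le_trans hfa.le (le_abs_self D)
      have key : dist (ξ i s) (ξ j s)
          ≤ dist (ξ i s) (ξ i a) + dist (ξ i a) (ξ j a) + dist (ξ j a) (ξ j s) :=
        dist_triangle4 _ _ _ _
      simp only [dist_eq_norm] at key
      have h5 : ‖ξ j a - ξ j s‖ = ‖ξ j s - ξ j a‖ := norm_sub_rev _ _
      linarith
    have hdrop : E (a + L) ≤ E a - ε := hc a haT i j hij hclose
    have hmono : E a ≤ E t₁ := hanti (mem_Ici.mpr ht₁) (mem_Ici.mpr haT) hat₁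
    have hmem : E (a + L) ∈ E '' Ici T := ⟨a + L, mem_Ici.mpr (by linarith), rfl⟩
    have hinf : sInf (E '' Ici T) ≤ E (a + L) := csInf_le hbdd hmem
    linarith
  -- The frame statement `Assembly` (item #1: thesis X → Statement) is pure logic; it is proved here
  -- and applied, so that `closes` is literally "cruxes ⊢ X, and X → Statement".
  have hA : Assembly := by
    rintro ⟨h₃, h₁, h₂, h₄⟩ X _ _ _ _ _ _
    -- tame Christodoulou genericity is monotone in the property under pointwise implication on 𝓓
    have mono : ∀ {P Q : Literature.Geometry.Lorentzian.InitialDataSet (𝓡 3) X → Prop},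
        Literature.Geometry.Lorentzian.InitialDataSet.IsTameChristodoulouGeneric
            (Literature.Geometry.Lorentzian.admissibleVacuumData X) P 1 →
          (∀ D ∈ Literature.Geometry.Lorentzian.admissibleVacuumData X, P D → Q D) →
            Literature.Geometry.Lorentzian.InitialDataSet.IsTameChristodoulouGeneric
              (Literature.Geometry.Lorentzian.admissibleVacuumData X) Q 1 := by
      intro P Q h hPQ d hd
      obtain ⟨e, F, hF, himm, h0, hinj, hDF, hE⟩ := h d ⟨hd.1, fun hP ↦ hd.2 (hPQ d hd.1 hP)⟩
      exact ⟨e, F, hF, himm, h0, hinj, hDF,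
        fun c hc hc' ↦ hE c hc ⟨hc'.1, fun hP ↦ hc'.2 (hPQ _ hc'.1 hP)⟩⟩
    refine mono (h₃ X) fun D hD hQD ↦ ⟨hQD.1, fun 𝒟 hmax ↦ ?_⟩
    obtain ⟨hscri, N, M, a, T, δ, V, C₁, C₂, ρ₀, κ, ξ, β, U₀, B₀, B, Ψ₀, Ψ, O, hera, hrays, hholes,
      hflat⟩ := hQD.2 𝒟 hmax
    refine ⟨hscri, ?_⟩
    -- the 31-clause package `IsFinalEra₂` is by definition the inline hypothesis of the budget item
    obtain ⟨E, hanti, hbdd, hcoer⟩ :=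
      h₁ X D hD 𝒟 hmax hscri N M a T δ V C₁ C₂ ρ₀ κ ξ β U₀ B₀ B Ψ₀ Ψ O hera
    -- dispersal from the budget and the Lipschitz speed clause (conjunct 14 of the package)
    have hdisp := h₂ N T V ξ E hera.2.2.2.2.2.2.2.2.2.2.2.2.2.1 hanti hbdd hcoer
    -- capture of the dispersing, oriented era is verbatim the Statement's clause
    exact h₄ X D hD 𝒟 hmax hscri N M a T δ V C₁ C₂ ρ₀ κ ξ β U₀ B₀ B Ψ₀ Ψ O hera hrays hholes hflat
      hdisp
  exact hA ⟨h₃, h₁, h₂, h₄⟩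

end Summit.FinalStateConjecture.FinalStateConjecture.Theses.DissipativeFinalMotions
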